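import Summits.Ventures.CertifiedManyBodySolver.Certificates.HubbardSquare_n7o8_tpm1o4_thermal_directSDP_fillingAffine
import Summits.Ventures.CertifiedManyBodySolver.Certificates.HubbardSquare_n7o8_tpm1o4_thermal_cells_t2_2t3_directSDP_r445_r448
import Summits.Ventures.CertifiedManyBodySolver.Certificates.HubbardSquare_n7o8_tpm1o4_thermal_cell_4t5_directSDP_r445_r448
import Summits.Ventures.CertifiedManyBodySolver.Certificates.HubbardSquare_n7o8_tpm1o4_thermal_cells_t1_4t3_directSDP_r445_r448
import Literature.MathematicalPhysics.QuantumLattice.TypeClassSidecarReaderAllTori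
import Literature.MathematicalPhysics.QuantumLattice.HubbardTTPrimeThermalPressureLimit
import HarnessLib

/-!
# Ventures/CertifiedManyBodySolver — CUPRATE-BOX CENTRE `(U, n, t′) = (8, 7/8, −1/4)`: the direct-SDP T-axis cells RE-READ AT hubbard-thermal-eng-2's
# SEAM-DRESSED C3 PRESSURE FLOORS by kernel algebra (input-affine plug through the filling-affine claim nodes; NO SDP re-run, no re-read)

HONEST FRAMING: first certified bounds; not a superconductivity verdict; every number certified or labelled float.
WHAT THIS IS NOT: not a phase sentence; not of record until the mbsolver LEAD pen + referee sign; every theorem below is CONDITIONAL on (i) the direct-SDP claim node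
named in its statement (hubbard-thermal-eng-1, certsdp cert/0 triple-equal, landed: p541815/p543217 for β = 4, 3 via the filling-affine twins p552093; p569119/p569116/
p571469 for β = 2, 3/2, 5/4, 1) and (ii) the C3 pressure floor stated as a HYPOTHESIS BY VALUE `hW : W0 ≤ pressureTT' β 1 (−1/4) 8 (7/8)` — hubbard-thermal-eng-2's
seam-dressed type-class trial-state floors (kit j284386/j284390, 3 × 3 plaq layout, 45 terms/box incl. diagonal bonds, exact dyadic gates, in-job verify_c3 ACCEPT;
JSONs `HOME/hubbard-thermal-eng-2/attempts/c3-j284386|j284390/cert_c3_3x3_plaq_tpm1o4_U8_<β>.json`, claim.W0), whose kernel node/reader (hubbard-thermal-p2/p1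
C3-READER-SPEC) discharges `hW` when it lands. Point cells at the box centre, not box words.

WHY (CERT-THERMAL §9 (e)/(f)): each certificate is affine in its free-energy input; the runs used p2's 3 × 3 C2 floors (β ≤ 3) or the T = 0 cap #445 (β = 4) as input `f₀`; a better
floor `W0` is an admissible input `f = −W0/β < f₀`, and the SAME multipliers certify `u₀ + K·(−W0/β − f₀)`.
TABLE (10-dp outward; every β′ ≥ β; lower edge #448 −0.8472749163 throughout):
  `T ≤ t/4` (β ≥ 4): C3 floor W0 = 2.8495159012, input shift Δf = -0.0257371904, K = 1.1751810479 ⇒ e(ω) ≤ -0.4788428186 (was -0.4485969602; eng-2 C3 chord -0.4641642158)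
  `T ≤ t/3` (β ≥ 3): C3 floor W0 = 2.3003865848, input shift Δf = -0.0446859638, K = 1.2240562488 ⇒ e(ω) ≤ -0.4488758540 (was -0.3941777208; eng-2 C3 chord -0.4264019489)
  `T ≤ t/2` (β ≥ 2): C3 floor W0 = 1.7748715707, input shift Δf = -0.0459864513, K = 1.3357894512 ⇒ e(ω) ≤ -0.3937684940 (was -0.3323402775; no eng-2 chord stated at this β)
  `T ≤ 2t/3` (β ≥ 3/2): C3 floor W0 = 1.5280278446, input shift Δf = -0.0468019560, K = 1.4526683642 ⇒ e(ω) ≤ -0.3423194180 (was -0.2743316972; no eng-2 chord stated at this β)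
  `T ≤ 4t/5` (β ≥ 5/4): C3 floor W0 = 1.4115067544, input shift Δf = -0.0472721900, K = 1.5345871435 ⇒ e(ω) ≤ -0.3002350374 (was -0.2276917424; no eng-2 chord stated at this β)
  `T ≤ t` (β ≥ 1): C3 floor W0 = 1.3021754541, input shift Δf = -0.0476884070, K = 1.6601623072 ⇒ e(ω) ≤ -0.2354085099 (was -0.1562380142; eng-2 C3 chord -0.1185824005)
At this point the direct-SDP cells plugged at C3 are TIGHTER than the C3 chords (the genuine hot anchors at t′ = −1/4 are few), e.g. T ≤ t/4 −0.4788… vs chord −0.4641642158,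
T ≤ t −0.2353… vs −0.1185824005; at t′ = 0 the order is the opposite by ≈ 2e-3 (eng-2's 3 × 2 anchors are genuine there).
[cite: Israel1979, Lemma II.3.1] [cite: Ruelle1969, §3.4] [cite: FawziFawziScalet2024, Theorem 3.1]
Seat prover-hubbard-thermal-eng-1-g3, 2026-08-27.
-/

noncomputable section

namespace Summit.Ventures.CertifiedManyBodySolver.Certificates

open Literature.MathematicalPhysics.QuantumLattice
open Literature.MathematicalPhysics.QuantumLattice.ThermodynamicLimit
open Literature.MathematicalPhysics.QuantumLattice.InfVolFermionState
open _root_.Filter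
open scoped ComplexOrder

/-- **C3 PLUG, `T ≤ t/4` (every β′ ≥ 4) at (8, 7/8, −1/4):** the direct-SDP certificate behind `cert_thSDP_tpm1o4_b4_C13tpb4_j276520` re-read at hubbard-thermal-eng-2's seam-dressed C3 floor
`W0(4) = 3133075866891 / 1099511627776` (≈ 2.8495159012; `HOME/hubbard-thermal-eng-2/attempts/c3-j284386/cert_c3_3x3_plaq_tpm1o4_U8_b4.json`, claim.W0, in-job verify_c3 ACCEPT) through the filling-affine node at `n′ = 7/8`:
`e(ω) ≤ u₀ + K·(−W0/β − f₀) = -0.4788428186…` ⇒ **`e(ω) ≤ -0.4788428186`** (10-dp outward; previous edge of this cell `-0.4485969602`, eng-2's own C3 chord `-0.4641642158`). The floor is a HYPOTHESIS BY VALUE (`hW`), discharged by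
eng-2's C3 node when it lands (p2/p1 C3 reader); NO SDP re-run. [cite: Israel1979, Lemma II.3.1] [cite: Ruelle1969, §3.4] -/
theorem thermal_tpm1o4_upper_directSDP_b4_C3plug_of_le (hSDP : cert_thSDP_tpm1o4_b4_C13tpb4_j276520_fillingAffine)
    (hW : (3133075866891 / 1099511627776 : ℝ) ≤ pressureTT' 4 1 (-1 / 4) 8 (7 / 8)) {β : ℝ} (hβ : (4 : ℝ) ≤ β) {ω : InfVolFermionState 2} {Ls : ℕ → ℕ}
    (h : ω.IsTorusLimitOfMixture (sectorGibbsCount (7 / 8)) (fun L => sectorGibbsWeightTT' β 1 (-1 / 4) 8 (7 / 8) L)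
      (fun L => sectorGibbsVectorTT' 1 (-1 / 4) 8 (7 / 8) L) Ls)
    (hLs : Tendsto Ls atTop atTop) :
    ω.meanEnergy (hubbardTTPrimeFermionInteraction 1 (-1 / 4) 8) 1 ≤ (-0.4788428186 : ℝ) := by
  refine IsTorusLimitOfMixture.meanEnergy_hubbardTTPrime_le_of_forall_at_hotter_allTori (t := 1) (t' := (-1 / 4)) (U := 8) (n := 7 / 8)
    (by norm_num) (by norm_num) (by norm_num) hβ (fun ω₁ Ls₁ hLs₁ h₁ => ?_) hLs h
  have h' := hSDP (7 / 8) (-(3133075866891 / 1099511627776 : ℝ) / 4) (by norm_num) (by norm_num)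
    (div_le_div_of_nonneg_right (neg_le_neg hW) (by norm_num)) ω₁ Ls₁ hLs₁ h₁
  norm_num at h' ⊢
  linarith


/-- **C3 PLUG, `T ≤ t/3` (every β′ ≥ 3) at (8, 7/8, −1/4):** the direct-SDP certificate behind `cert_thSDP_tpm1o4_b3_C13tpb3_j276521` re-read at hubbard-thermal-eng-2's seam-dressed C3 floor
`W0(3) = 158081362395 / 68719476736` (≈ 2.3003865848; `HOME/hubbard-thermal-eng-2/attempts/c3-j284386/cert_c3_3x3_plaq_tpm1o4_U8_b3.json`, claim.W0, in-job verify_c3 ACCEPT) through the filling-affine node at `n′ = 7/8`: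
`e(ω) ≤ u₀ + K·(−W0/β − f₀) = -0.4488758540…` ⇒ **`e(ω) ≤ -0.4488758540`** (10-dp outward; previous edge of this cell `-0.3941777208`, eng-2's own C3 chord `-0.4264019489`). The floor is a HYPOTHESIS BY VALUE (`hW`), discharged by
eng-2's C3 node when it lands (p2/p1 C3 reader); NO SDP re-run. [cite: Israel1979, Lemma II.3.1] [cite: Ruelle1969, §3.4] -/
theorem thermal_tpm1o4_upper_directSDP_b3_C3plug_of_le (hSDP : cert_thSDP_tpm1o4_b3_C13tpb3_j276521_fillingAffine)
    (hW : (158081362395 / 68719476736 : ℝ) ≤ pressureTT' 3 1 (-1 / 4) 8 (7 / 8)) {β : ℝ} (hβ : (3 : ℝ) ≤ β) {ω : InfVolFermionState 2} {Ls : ℕ → ℕ}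
    (h : ω.IsTorusLimitOfMixture (sectorGibbsCount (7 / 8)) (fun L => sectorGibbsWeightTT' β 1 (-1 / 4) 8 (7 / 8) L)
      (fun L => sectorGibbsVectorTT' 1 (-1 / 4) 8 (7 / 8) L) Ls)
    (hLs : Tendsto Ls atTop atTop) :
    ω.meanEnergy (hubbardTTPrimeFermionInteraction 1 (-1 / 4) 8) 1 ≤ (-0.4488758540 : ℝ) := by
  refine IsTorusLimitOfMixture.meanEnergy_hubbardTTPrime_le_of_forall_at_hotter_allTori (t := 1) (t' := (-1 / 4)) (U := 8) (n := 7 / 8)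
    (by norm_num) (by norm_num) (by norm_num) hβ (fun ω₁ Ls₁ hLs₁ h₁ => ?_) hLs h
  have h' := hSDP (7 / 8) (-(158081362395 / 68719476736 : ℝ) / 3) (by norm_num) (by norm_num)
    (div_le_div_of_nonneg_right (neg_le_neg hW) (by norm_num)) ω₁ Ls₁ hLs₁ h₁
  norm_num at h' ⊢
  linarith


/-- **C3 PLUG, `T ≤ t/2` (every β′ ≥ 2) at (8, 7/8, −1/4):** the direct-SDP certificate behind `cert_thSDP_tpm1o4_b2_P1tpb2_j284125` re-read at hubbard-thermal-eng-2's seam-dressed C3 floor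
`W0(2) = 243936491229 / 137438953472` (≈ 1.7748715707; `HOME/hubbard-thermal-eng-2/attempts/c3-j284386/cert_c3_3x3_plaq_tpm1o4_U8_b2.json`, claim.W0, in-job verify_c3 ACCEPT) through the filling-affine node at `n′ = 7/8`:
`e(ω) ≤ u₀ + K·(−W0/β − f₀) = -0.3937684941…` ⇒ **`e(ω) ≤ -0.3937684940`** (10-dp outward; previous edge of this cell `-0.3323402775`). The floor is a HYPOTHESIS BY VALUE (`hW`), discharged by
eng-2's C3 node when it lands (p2/p1 C3 reader); NO SDP re-run. [cite: Israel1979, Lemma II.3.1] [cite: Ruelle1969, §3.4] -/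
theorem thermal_tpm1o4_upper_directSDP_b2_C3plug_of_le (hSDP : cert_thSDP_tpm1o4_b2_P1tpb2_j284125_fillingAffine)
    (hW : (243936491229 / 137438953472 : ℝ) ≤ pressureTT' 2 1 (-1 / 4) 8 (7 / 8)) {β : ℝ} (hβ : (2 : ℝ) ≤ β) {ω : InfVolFermionState 2} {Ls : ℕ → ℕ}
    (h : ω.IsTorusLimitOfMixture (sectorGibbsCount (7 / 8)) (fun L => sectorGibbsWeightTT' β 1 (-1 / 4) 8 (7 / 8) L)
      (fun L => sectorGibbsVectorTT' 1 (-1 / 4) 8 (7 / 8) L) Ls)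
    (hLs : Tendsto Ls atTop atTop) :
    ω.meanEnergy (hubbardTTPrimeFermionInteraction 1 (-1 / 4) 8) 1 ≤ (-0.3937684940 : ℝ) := by
  refine IsTorusLimitOfMixture.meanEnergy_hubbardTTPrime_le_of_forall_at_hotter_allTori (t := 1) (t' := (-1 / 4)) (U := 8) (n := 7 / 8)
    (by norm_num) (by norm_num) (by norm_num) hβ (fun ω₁ Ls₁ hLs₁ h₁ => ?_) hLs h
  have h' := hSDP (7 / 8) (-(243936491229 / 137438953472 : ℝ) / 2) (by norm_num) (by norm_num)
    (div_le_div_of_nonneg_right (neg_le_neg hW) (by norm_num)) ω₁ Ls₁ hLs₁ h₁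
  norm_num at h' ⊢
  linarith


/-- **C3 PLUG, `T ≤ 2t/3` (every β′ ≥ 3/2) at (8, 7/8, −1/4):** the direct-SDP certificate behind `cert_thSDP_tpm1o4_b3o2_P1tpb3o2_j284125` re-read at hubbard-thermal-eng-2's seam-dressed C3 floor
`W0(3/2) = 1680084382749 / 1099511627776` (≈ 1.5280278446; `HOME/hubbard-thermal-eng-2/attempts/c3-j284390/cert_c3_3x3_plaq_tpm1o4_U8_b3o2.json`, claim.W0, in-job verify_c3 ACCEPT) through the filling-affine node at `n′ = 7/8`:
`e(ω) ≤ u₀ + K·(−W0/β − f₀) = -0.3423194180…` ⇒ **`e(ω) ≤ -0.3423194180`** (10-dp outward; previous edge of this cell `-0.2743316972`). The floor is a HYPOTHESIS BY VALUE (`hW`), discharged by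
eng-2's C3 node when it lands (p2/p1 C3 reader); NO SDP re-run. [cite: Israel1979, Lemma II.3.1] [cite: Ruelle1969, §3.4] -/
theorem thermal_tpm1o4_upper_directSDP_b3o2_C3plug_of_le (hSDP : cert_thSDP_tpm1o4_b3o2_P1tpb3o2_j284125_fillingAffine)
    (hW : (1680084382749 / 1099511627776 : ℝ) ≤ pressureTT' (3 / 2) 1 (-1 / 4) 8 (7 / 8)) {β : ℝ} (hβ : ((3 / 2) : ℝ) ≤ β) {ω : InfVolFermionState 2} {Ls : ℕ → ℕ}
    (h : ω.IsTorusLimitOfMixture (sectorGibbsCount (7 / 8)) (fun L => sectorGibbsWeightTT' β 1 (-1 / 4) 8 (7 / 8) L)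
      (fun L => sectorGibbsVectorTT' 1 (-1 / 4) 8 (7 / 8) L) Ls)
    (hLs : Tendsto Ls atTop atTop) :
    ω.meanEnergy (hubbardTTPrimeFermionInteraction 1 (-1 / 4) 8) 1 ≤ (-0.3423194180 : ℝ) := by
  refine IsTorusLimitOfMixture.meanEnergy_hubbardTTPrime_le_of_forall_at_hotter_allTori (t := 1) (t' := (-1 / 4)) (U := 8) (n := 7 / 8)
    (by norm_num) (by norm_num) (by norm_num) hβ (fun ω₁ Ls₁ hLs₁ h₁ => ?_) hLs h
  have h' := hSDP (7 / 8) (-(1680084382749 / 1099511627776 : ℝ) / (3 / 2)) (by norm_num) (by norm_num)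
    (div_le_div_of_nonneg_right (neg_le_neg hW) (by norm_num)) ω₁ Ls₁ hLs₁ h₁
  norm_num at h' ⊢
  linarith


/-- **C3 PLUG, `T ≤ 4t/5` (every β′ ≥ 5/4) at (8, 7/8, −1/4):** the direct-SDP certificate behind `cert_thSDP_tpm1o4_b5o4_P1tpb5o4_j284125` re-read at hubbard-thermal-eng-2's seam-dressed C3 floor
`W0(5/4) = 1551968089163 / 1099511627776` (≈ 1.4115067544; `HOME/hubbard-thermal-eng-2/attempts/c3-j284390/cert_c3_3x3_plaq_tpm1o4_U8_b5o4.json`, claim.W0, in-job verify_c3 ACCEPT) through the filling-affine node at `n′ = 7/8`: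
`e(ω) ≤ u₀ + K·(−W0/β − f₀) = -0.3002350375…` ⇒ **`e(ω) ≤ -0.3002350374`** (10-dp outward; previous edge of this cell `-0.2276917424`). The floor is a HYPOTHESIS BY VALUE (`hW`), discharged by
eng-2's C3 node when it lands (p2/p1 C3 reader); NO SDP re-run. [cite: Israel1979, Lemma II.3.1] [cite: Ruelle1969, §3.4] -/
theorem thermal_tpm1o4_upper_directSDP_b5o4_C3plug_of_le (hSDP : cert_thSDP_tpm1o4_b5o4_P1tpb5o4_j284125_fillingAffine)
    (hW : (1551968089163 / 1099511627776 : ℝ) ≤ pressureTT' (5 / 4) 1 (-1 / 4) 8 (7 / 8)) {β : ℝ} (hβ : ((5 / 4) : ℝ) ≤ β) {ω : InfVolFermionState 2} {Ls : ℕ → ℕ}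
    (h : ω.IsTorusLimitOfMixture (sectorGibbsCount (7 / 8)) (fun L => sectorGibbsWeightTT' β 1 (-1 / 4) 8 (7 / 8) L)
      (fun L => sectorGibbsVectorTT' 1 (-1 / 4) 8 (7 / 8) L) Ls)
    (hLs : Tendsto Ls atTop atTop) :
    ω.meanEnergy (hubbardTTPrimeFermionInteraction 1 (-1 / 4) 8) 1 ≤ (-0.3002350374 : ℝ) := by
  refine IsTorusLimitOfMixture.meanEnergy_hubbardTTPrime_le_of_forall_at_hotter_allTori (t := 1) (t' := (-1 / 4)) (U := 8) (n := 7 / 8)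
    (by norm_num) (by norm_num) (by norm_num) hβ (fun ω₁ Ls₁ hLs₁ h₁ => ?_) hLs h
  have h' := hSDP (7 / 8) (-(1551968089163 / 1099511627776 : ℝ) / (5 / 4)) (by norm_num) (by norm_num)
    (div_le_div_of_nonneg_right (neg_le_neg hW) (by norm_num)) ω₁ Ls₁ hLs₁ h₁
  norm_num at h' ⊢
  linarith


/-- **C3 PLUG, `T ≤ t` (every β′ ≥ 1) at (8, 7/8, −1/4):** the direct-SDP certificate behind `cert_thSDP_tpm1o4_b1_P1tpb1_j284435` re-read at hubbard-thermal-eng-2's seam-dressed C3 floor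
`W0(1) = 715878526609 / 549755813888` (≈ 1.3021754541; `HOME/hubbard-thermal-eng-2/attempts/c3-j284390/cert_c3_3x3_plaq_tpm1o4_U8_b1.json`, claim.W0, in-job verify_c3 ACCEPT) through the filling-affine node at `n′ = 7/8`:
`e(ω) ≤ u₀ + K·(−W0/β − f₀) = -0.2354085099…` ⇒ **`e(ω) ≤ -0.2354085099`** (10-dp outward; previous edge of this cell `-0.1562380142`, eng-2's own C3 chord `-0.1185824005`). The floor is a HYPOTHESIS BY VALUE (`hW`), discharged by
eng-2's C3 node when it lands (p2/p1 C3 reader); NO SDP re-run. [cite: Israel1979, Lemma II.3.1] [cite: Ruelle1969, §3.4] -/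
theorem thermal_tpm1o4_upper_directSDP_b1_C3plug_of_le (hSDP : cert_thSDP_tpm1o4_b1_P1tpb1_j284435_fillingAffine)
    (hW : (715878526609 / 549755813888 : ℝ) ≤ pressureTT' 1 1 (-1 / 4) 8 (7 / 8)) {β : ℝ} (hβ : (1 : ℝ) ≤ β) {ω : InfVolFermionState 2} {Ls : ℕ → ℕ}
    (h : ω.IsTorusLimitOfMixture (sectorGibbsCount (7 / 8)) (fun L => sectorGibbsWeightTT' β 1 (-1 / 4) 8 (7 / 8) L)
      (fun L => sectorGibbsVectorTT' 1 (-1 / 4) 8 (7 / 8) L) Ls)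
    (hLs : Tendsto Ls atTop atTop) :
    ω.meanEnergy (hubbardTTPrimeFermionInteraction 1 (-1 / 4) 8) 1 ≤ (-0.2354085099 : ℝ) := by
  refine IsTorusLimitOfMixture.meanEnergy_hubbardTTPrime_le_of_forall_at_hotter_allTori (t := 1) (t' := (-1 / 4)) (U := 8) (n := 7 / 8)
    (by norm_num) (by norm_num) (by norm_num) hβ (fun ω₁ Ls₁ hLs₁ h₁ => ?_) hLs h
  have h' := hSDP (7 / 8) (-(715878526609 / 549755813888 : ℝ) / 1) (by norm_num) (by norm_num)
    (div_le_div_of_nonneg_right (neg_le_neg hW) (by norm_num)) ω₁ Ls₁ hLs₁ h₁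
  norm_num at h' ⊢
  linarith


end Summit.Ventures.CertifiedManyBodySolver.Certificates

end
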